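import Literature.NumberTheory.Automorphic.AdelicThetaTailRayDecay          -- ★ theta-tail ray decay (vector currency `Fin N → 𝔸_K`), Godement–Jacquet §11
import Literature.NumberTheory.Automorphic.ChirpDilationSupReduction        -- ★ `𝕀_K = K^× · C · z(ℝ_{>0})`, `C` compact (Weil BNT IV §4 Thm 6)
import Literature.NumberTheory.Automorphic.AdelicHeightGLSiegel             -- ★ `GLn.continuous_archHeight`
import Literature.NumberTheory.Automorphic.AutomorphicFormsGLContinuous     -- ★ `GLn.continuous_sndHom`
import Literature.NumberTheory.Automorphic.AdelicGroupDataGLOneProofs       -- ★ `continuous_generalLinearGroup_scalar`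
import Mathlib.Analysis.SpecialFunctions.Pow.Real
import HarnessLib

/-!
# h413 ∕ Track B «K2-LIT», page EIS-RANK-ONE, rung R6d — `K2E1AdelicFourierDecay`: LATTICE SUMS OF A DECAYING FUNCTION ON `𝔸_K` DECAY UNDER IDELE DILATION,
# `Σ_{ξ ∈ K^×} |Ψ(ξ t)| ≤ C · |t|^{-β}` for EVERY idele `t`, uniformly over the decay class of `Ψ` (number-field generic)

Cell `pub/hodgecm-mathlib`, crux H413 = `stmt-HodgeConjecture-24833` (supports-only helper, count-neutral), route `HCCMUnconditional`; dealer K2E1-plan (g3), deal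
«EIS-R6d-engine» 2026-09-04T05:06:41Z → K2E4-p10 (g3); SPEC `K2/K2E1-plan/g3/SPEC-EIS-R6-MaassSelberg.K2E1-plan-g3.md` §2 R6d.  THEOREMS ONLY (no `def`, no `instance`,
no `notation`, no named-fact hypothesis, no `sorry`).

## The statement

Let `K` be a number field, `d = [K:ℚ]`, `𝔸 = 𝔸_K`.  Fix an archimedean decay order `k`, a constant `M ≥ 0`, a compact set `C_f ⊆ 𝔸_K^∞` of finite adeles and an exponent
`θ ∈ (d, k]`.  THEN THERE IS ONE CONSTANT `C ≥ 0` SUCH THAT FOR EVERY `Ψ : 𝔸 → ℂ` with `|Ψ(x)| ≤ M (1 + ‖x_∞‖)^{-k}` and `Ψ(x) = 0` unless `x_f ∈ C_f`, AND EVERY IDELE `t`: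
`Σ_{ξ ∈ K} |Ψ(ξ t)|` converges and **`Σ_{ξ ∈ K, ξ ≠ 0} |Ψ(ξ t)| ≤ C · |t|_𝔸^{-θ/d}`** (`exists_forall_tsum_indicator_norm_mul_le_rpow_neg`).  In the Maass–Selberg page this is
the analytic heart of R6d: with `Ψ = 𝓕Φ_k` the adelic Fourier transform of the big-cell section (a Schwartz–Bruhat function, so in the class for every `k`) and `t = λ⁻¹`
it is literally the binder `hdec` of ★ `K2E1EisensteinMinusConstantTermBoundU2.norm_sub_borelConstantTerm_le_of_decay_two` (`_inv` form below), giving the decay of `E − E_B`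
high in the cusp, uniformly in `k ∈ K_U` (one constant for the whole decay class) and locally uniformly in the spectral parameter.

## The proof (all inputs ★; this file is the `N = 1` bridge and the compact·ray bookkeeping)

1. `K^×`-INVARIANCE (`tsum_indicator_norm_mul_principal`): `ξ ↦ ξ q₀` permutes `K^×`, so the sum at `q t` (`q = (q₀)` principal) equals the sum at `t`.
2. COMPACT·RAY REDUCTION: every idele is `t = q · c · z(r)` with `q` principal, `c` in a fixed compact `C ⊆ 𝕀_K` and `z(r)` the archimedean positive scalar idele
   (★ `exists_normOneIdeles_mul_posRealIdele`, ★ `exists_isCompact_normOneIdeles_subset` — the compactness of `𝕀_K¹∕K^×`, Weil BNT IV §4 Thm 6); by the product formula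
   (★ `ideleNorm_principal`) and ★ `ideleNorm_posRealIdele_holds`, `|t| = |c| · r^d` with `|c|` bounded on `C` (★ `continuous_ideleNorm_holds`).
3. RAY DECAY (★ `exists_tsum_enorm_vecMul_tail_ray_le_archHeight_rpow` at `N = 1`, Godement–Jacquet LNM 260 §11): for `L = (c)`, `c ∈ C` (finite parts in a compact,
   archimedean heights bounded by ★ `GLn.continuous_archHeight`), `Σ_{ξ ≠ 0} |Ψ₀(ξ c z(r))| ≤ (r⁻¹)^θ · B` for the ENVELOPE `Ψ₀(x) = M(1+‖x_∞‖)^{-k} 𝟙_{C_f}(x_f)` — one `B` for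
   the whole class, every member being dominated termwise by `Ψ₀`; and `(r⁻¹)^θ = (|c|∕|t|)^{θ/d} ≤ b^{θ/d} |t|^{-θ/d}`.

HONEST LABEL.  Count-neutral helper; proves no printed statement; HC_CM is proved only modulo the 7 printed citations (2 remaining named inputs: hLiu418 =
`stmt-HodgeConjecture-24832`, h413 = `stmt-HodgeConjecture-24833`) until rung 0 closes.

## References
* [GodementJacquetLNM260] R. Godement, H. Jacquet, *Zeta functions of simple algebras*, LNM 260 (1972), §11 (Lemmas 11.5–11.6).
* [WeilBNT1967] A. Weil, *Basic Number Theory* (1967), Ch. IV §4 (Thm 5, Cor. 2; Thm 6).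
* [CasselsFrohlichANT1967] J. Tate, *Fourier analysis in number fields and Hecke's zeta-functions*, Ch. XV of Cassels–Fröhlich (1967), §4.1–4.2 (Lemma 4.2.4: the theta sum
  `Σ_ξ f(ξ t)` and its behaviour as `|t| → ∞`).
* [MoeglinWaldspurger1995] C. Mœglin, J.-L. Waldspurger, *Spectral decomposition and Eisenstein series* (1995), I.2.10–I.2.13, II.1.
-/

set_option autoImplicit false
set_option linter.dupNamespace false  -- the mandated namespace repeats the summit's segment (`HodgeConjecture.HodgeConjecture`)

noncomputable section

open scoped NNReal ENNReal Pointwise Classical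
open NumberField NumberField.mixedEmbedding IsDedekindDomain Set MeasureTheory Matrix Module
open Literature.NumberTheory.Automorphic Literature.NumberTheory.GaloisRepresentations

namespace Summit.HodgeConjecture.HodgeConjecture.Cruxes.H413.K2E1AdelicFourierDecay

variable (K : Type) [Field K] [NumberField K]

/-! ## §1 `K^×`-invariance of the lattice sum -/

/-- **The lattice sum is invariant under principal ideles**: `Σ_{ξ ≠ 0} |Ψ(ξ q t)| = Σ_{ξ ≠ 0} |Ψ(ξ t)|` for `q = (q₀)`, `q₀ ∈ K^×` (`ξ ↦ ξ q₀` permutes `K ∖ {0}`).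
[cite: CasselsFrohlichANT1967, Ch. XV §4.2] -/
theorem tsum_indicator_norm_mul_principal (Ψ : AdeleRing (𝓞 K) K → ℂ) {q : ideleGroup K} (hq : q ∈ principalIdeles K) (t : ideleGroup K) :
    ∑' ξ : K, ({0}ᶜ : Set K).indicator (fun ξ => ‖Ψ (algebraMap K (AdeleRing (𝓞 K) K) ξ * ((q * t : ideleGroup K) : AdeleRing (𝓞 K) K))‖) ξ =
      ∑' ξ : K, ({0}ᶜ : Set K).indicator (fun ξ => ‖Ψ (algebraMap K (AdeleRing (𝓞 K) K) ξ * (t : AdeleRing (𝓞 K) K))‖) ξ := by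
  obtain ⟨u, rfl⟩ := hq
  -- reindex along `ξ ↦ ξ u`
  let e : K ≃ K := Equiv.mulRight₀ (u : K) u.ne_zero
  conv_rhs => rw [← Equiv.tsum_eq e]
  refine tsum_congr fun ξ => ?_
  have he : e ξ = ξ * u := rfl
  by_cases hξ : ξ = 0
  · subst hξ
    simp only [he, zero_mul, Set.indicator_of_notMem (Set.notMem_compl_iff.2 (Set.mem_singleton (0 : K)))]
  · have hξu : ξ * (u : K) ≠ 0 := mul_ne_zero hξ u.ne_zero
    rw [Set.indicator_of_mem (show e ξ ∈ ({0}ᶜ : Set K) from by rw [he]; exact hξu), Set.indicator_of_mem (show ξ ∈ ({0}ᶜ : Set K) from hξ), he,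
      Units.val_mul, Units.coe_map, MonoidHom.coe_coe, map_mul, mul_assoc]

/-- The FULL sum `Σ_{ξ ∈ K} |Ψ(ξ q t)|` is the reindexing of `Σ_ξ |Ψ(ξ t)|` along `ξ ↦ ξ q₀`; in particular summability transfers. [cite: CasselsFrohlichANT1967, Ch. XV §4.2] -/
theorem summable_norm_mul_principal_iff (Ψ : AdeleRing (𝓞 K) K → ℂ) {q : ideleGroup K} (hq : q ∈ principalIdeles K) (t : ideleGroup K) :
    Summable (fun ξ : K => ‖Ψ (algebraMap K (AdeleRing (𝓞 K) K) ξ * ((q * t : ideleGroup K) : AdeleRing (𝓞 K) K))‖) ↔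
      Summable (fun ξ : K => ‖Ψ (algebraMap K (AdeleRing (𝓞 K) K) ξ * (t : AdeleRing (𝓞 K) K))‖) := by
  obtain ⟨u, rfl⟩ := hq
  let e : K ≃ K := Equiv.mulRight₀ (u : K) u.ne_zero
  have h : (fun ξ : K => ‖Ψ (algebraMap K (AdeleRing (𝓞 K) K) ξ * ((Units.map (algebraMap K (AdeleRing (𝓞 K) K) : K →* AdeleRing (𝓞 K) K) u * t : ideleGroup K) :
      AdeleRing (𝓞 K) K))‖) = (fun ξ : K => ‖Ψ (algebraMap K (AdeleRing (𝓞 K) K) ξ * (t : AdeleRing (𝓞 K) K))‖) ∘ e := by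
    funext ξ
    simp only [Function.comp_apply, e, Equiv.mulRight₀_apply, Units.val_mul, Units.coe_map, MonoidHom.coe_coe, map_mul, mul_assoc]
  rw [h]
  exact Equiv.summable_iff e

/-! ## §2 The `N = 1` bridge to the ★ theta-tail ray decay: one bound for the whole decay class on `C · z(ℝ_{>0})` -/

/-- `x ↦ x 0` on `Fin 1 → 𝔸_K`: the vector `ξ · (u)` has coordinate `ξ u`. [folklore] -/
theorem ratVec_vecMul_scalar_apply (v : Fin 1 → K) (u : ideleGroup K) (i : Fin 1) :
    (ratVec K v ᵥ* ((Matrix.GeneralLinearGroup.scalar (Fin 1) u : GL (Fin 1) (AdeleRing (𝓞 K) K)) : Matrix (Fin 1) (Fin 1) (AdeleRing (𝓞 K) K))) i =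
      algebraMap K (AdeleRing (𝓞 K) K) (v i) * (u : AdeleRing (𝓞 K) K) := by
  have h : ((Matrix.GeneralLinearGroup.scalar (Fin 1) u : GL (Fin 1) (AdeleRing (𝓞 K) K)) : Matrix (Fin 1) (Fin 1) (AdeleRing (𝓞 K) K)) =
      Matrix.diagonal fun _ => (u : AdeleRing (𝓞 K) K) := rfl
  rw [h, Matrix.vecMul_diagonal]
  rfl

/-- The sup norm of a `Fin 1`-vector is the norm of its entry. [folklore] -/
theorem norm_fin_one {E : Type*} [SeminormedAddCommGroup E] (f : Fin 1 → E) : ‖f‖ = ‖f 0‖ := by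
  rw [Pi.norm_def]
  have h : (Finset.univ : Finset (Fin 1)) = {0} := Finset.univ_unique
  rw [h, Finset.sup_singleton, coe_nnnorm]

/-- **ONE BOUND FOR THE WHOLE DECAY CLASS ON `C · z(ℝ_{>0})`** (`C ⊆ 𝕀_K` compact): there is `B ≥ 0` such that for every `Ψ` with `|Ψ(x)| ≤ M(1+‖x_∞‖)^{-k}` vanishing unless
`x_f ∈ C_f`, every `c ∈ C` and every `r > 0`, the sum `Σ_{ξ ∈ K} |Ψ(ξ c z(r))|` converges and `Σ_{ξ ≠ 0} |Ψ(ξ c z(r))| ≤ (r⁻¹)^θ · B` (`θ ∈ ([K:ℚ], k]`) — ★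
`exists_tsum_enorm_vecMul_tail_ray_le_archHeight_rpow` at `N = 1` applied to the ENVELOPE `Ψ₀ = M(1+‖x_∞‖)^{-k}𝟙_{C_f}`, with the archimedean heights of `(c)`, `c ∈ C`, bounded by
compactness (★ `GLn.continuous_archHeight`). [cite: GodementJacquetLNM260, §11] -/
theorem exists_forall_tsum_norm_mul_ray_le {k : ℕ} {M : ℝ} (hM0 : 0 ≤ M) {Cf : Set (FiniteAdeleRing (𝓞 K) K)} (hCfc : IsCompact Cf)
    {C : Set (ideleGroup K)} (hC : IsCompact C) {θ : ℝ} (hθ : (finrank ℚ K : ℝ) < θ) (hθk : θ ≤ k) :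
    ∃ B : ℝ, 0 ≤ B ∧ ∀ Ψ : AdeleRing (𝓞 K) K → ℂ,
      (∀ x, ‖Ψ x‖ ≤ M * (1 + ‖InfiniteAdeleRing.ringEquiv_mixedSpace K x.1‖) ^ (-(k : ℝ))) → (∀ x, x.2 ∉ Cf → Ψ x = 0) →
      ∀ c ∈ C, ∀ r : ℝ≥0ˣ,
        Summable (fun ξ : K => ‖Ψ (algebraMap K (AdeleRing (𝓞 K) K) ξ * ((c * posRealIdele K r : ideleGroup K) : AdeleRing (𝓞 K) K))‖) ∧
        ∑' ξ : K, ({0}ᶜ : Set K).indicator (fun ξ => ‖Ψ (algebraMap K (AdeleRing (𝓞 K) K) ξ * ((c * posRealIdele K r : ideleGroup K) : AdeleRing (𝓞 K) K))‖) ξ ≤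
          (((r : ℝ≥0) : ℝ)⁻¹) ^ θ * B := by
  -- the envelope on `Fin 1 → 𝔸_K`
  set Cf₁ : Set (Fin 1 → FiniteAdeleRing (𝓞 K) K) := {y | y 0 ∈ Cf} with hCf₁
  have hCf₁c : IsCompact Cf₁ := by
    have h : Cf₁ = (Homeomorph.funUnique (Fin 1) (FiniteAdeleRing (𝓞 K) K)) ⁻¹' Cf := rfl
    rw [h]
    exact (Homeomorph.isCompact_preimage _).2 hCfc
  set Ψ₀ : (Fin 1 → AdeleRing (𝓞 K) K) → ℂ := fun x =>
    if vecFinitePart K 1 x ∈ Cf₁ then ((M * (1 + ‖vecInfinitePart K 1 x‖) ^ (-(k : ℝ)) : ℝ) : ℂ) else 0 with hΨ₀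
  have hpow0 : ∀ x : Fin 1 → AdeleRing (𝓞 K) K, 0 ≤ M * (1 + ‖vecInfinitePart K 1 x‖) ^ (-(k : ℝ)) := fun x =>
    mul_nonneg hM0 (Real.rpow_nonneg (by positivity) _)
  have hM₀ : ∀ x, ‖Ψ₀ x‖ ≤ M * (1 + ‖vecInfinitePart K 1 x‖) ^ (-(k : ℝ)) := by
    intro x
    by_cases hx : vecFinitePart K 1 x ∈ Cf₁
    · rw [hΨ₀]; simp only [hx, if_true, Complex.norm_real, Real.norm_eq_abs, abs_of_nonneg (hpow0 x), le_refl]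
    · rw [hΨ₀]; simp only [hx, if_false, norm_zero]; exact hpow0 x
  have hCf₀ : ∀ x, vecFinitePart K 1 x ∉ Cf₁ → Ψ₀ x = 0 := fun x hx => by rw [hΨ₀]; simp only [hx, if_false]
  -- the compact set of finite parts of `(c)`, `c ∈ C`
  set 𝒴 : Set (GL (Fin 1) (FiniteAdeleRing (𝓞 K) K)) := (fun c : ideleGroup K => GLn.sndHom 1 K (Matrix.GeneralLinearGroup.scalar (Fin 1) c)) '' C with h𝒴
  have hsc : Continuous (Matrix.GeneralLinearGroup.scalar (Fin 1) : ideleGroup K → GL (Fin 1) (AdeleRing (𝓞 K) K)) :=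
    continuous_generalLinearGroup_scalar (Fin 1)
  have h𝒴c : IsCompact 𝒴 := hC.image (GLn.continuous_sndHom.comp hsc)
  have hθ' : ((1 : ℕ) : ℝ) * finrank ℚ K < θ := by rwa [Nat.cast_one, one_mul]
  obtain ⟨B, hBtop, hB⟩ := exists_tsum_enorm_vecMul_tail_ray_le_archHeight_rpow K hM0 hM₀ hCf₁c hCf₀ h𝒴c hθ' hθk
  -- archimedean heights are bounded on `C`
  obtain ⟨H, hH⟩ := hC.bddAbove_image (f := fun c : ideleGroup K => ((GLn.archHeight 1 K (Matrix.GeneralLinearGroup.scalar (Fin 1) c) : ℝ≥0) : ℝ))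
    ((NNReal.continuous_coe.comp (GLn.continuous_archHeight.comp hsc)).continuousOn)
  have hHc : ∀ c ∈ C, ((GLn.archHeight 1 K (Matrix.GeneralLinearGroup.scalar (Fin 1) c) : ℝ≥0) : ℝ) ≤ H := fun c hc => hH ⟨c, hc, rfl⟩
  have hθ0 : 0 ≤ θ := le_trans (by positivity) hθ.le
  set m : ℝ := max 1 (((1 : ℕ) : ℝ) ^ 2 * H) with hm
  refine ⟨B.toReal * m ^ θ, mul_nonneg ENNReal.toReal_nonneg (Real.rpow_nonneg (zero_le_one.trans (le_max_left _ _)) _), ?_⟩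
  intro Ψ hM hCf c hc r
  set u : ideleGroup K := c * posRealIdele K r with hu
  -- the ray point: `(c) · z(r⁻¹)⁻¹ = (c z(r))`
  have hL : Matrix.GeneralLinearGroup.scalar (Fin 1) c * (posRealScalar 1 K r⁻¹)⁻¹ = Matrix.GeneralLinearGroup.scalar (Fin 1) u := by
    rw [show posRealScalar 1 K r⁻¹ = Matrix.GeneralLinearGroup.scalar (Fin 1) (posRealIdele K r⁻¹) from rfl, ← map_inv, ← map_mul, map_inv, inv_inv]
  have hray := hB (Matrix.GeneralLinearGroup.scalar (Fin 1) c) ⟨c, hc, rfl⟩ r⁻¹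
  rw [hL] at hray
  -- termwise domination of `Ψ` by the envelope along the lattice
  have hdom : ∀ ξ : K, (‖Ψ (algebraMap K (AdeleRing (𝓞 K) K) ξ * (u : AdeleRing (𝓞 K) K))‖ₑ : ℝ≥0∞) ≤
      ‖Ψ₀ (ratVec K (fun _ : Fin 1 => ξ) ᵥ* ((Matrix.GeneralLinearGroup.scalar (Fin 1) u : GL (Fin 1) (AdeleRing (𝓞 K) K)) :
        Matrix (Fin 1) (Fin 1) (AdeleRing (𝓞 K) K)))‖ₑ := by
    intro ξ
    set x : Fin 1 → AdeleRing (𝓞 K) K := ratVec K (fun _ : Fin 1 => ξ) ᵥ*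
      ((Matrix.GeneralLinearGroup.scalar (Fin 1) u : GL (Fin 1) (AdeleRing (𝓞 K) K)) : Matrix (Fin 1) (Fin 1) (AdeleRing (𝓞 K) K)) with hx
    have hx0 : x 0 = algebraMap K (AdeleRing (𝓞 K) K) ξ * (u : AdeleRing (𝓞 K) K) := ratVec_vecMul_scalar_apply K _ u 0
    rw [← hx0]
    have hreal : ‖Ψ (x 0)‖ ≤ ‖Ψ₀ x‖ := by
      by_cases hxf : vecFinitePart K 1 x ∈ Cf₁
      · have h1 : ‖vecInfinitePart K 1 x‖ = ‖InfiniteAdeleRing.ringEquiv_mixedSpace K (x 0).1‖ := norm_fin_one _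
        rw [hΨ₀]
        simp only [hxf, if_true, Complex.norm_real, Real.norm_eq_abs, h1]
        rw [abs_of_nonneg (by rw [← h1]; exact hpow0 x)]
        exact hM (x 0)
      · have h0 : Ψ (x 0) = 0 := hCf (x 0) hxf
        rw [h0, norm_zero]
        exact norm_nonneg _
    rw [← ofReal_norm, ← ofReal_norm]
    exact ENNReal.ofReal_le_ofReal hreal
  -- the tail sum over `K ∖ {0}` in `ℝ≥0∞`, reindexed to `{v : Fin 1 → K | v ≠ 0}`
  let eK : ↥({0}ᶜ : Set K) ≃ ↥{v : Fin 1 → K | v ≠ 0} :=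
    { toFun := fun ξ => ⟨fun _ => ξ.1, fun h => ξ.2 (congr_fun h 0)⟩
      invFun := fun v => ⟨v.1 0, fun h => v.2 (funext fun i => by rw [Subsingleton.elim i 0]; exact h)⟩
      left_inv := fun ξ => rfl
      right_inv := fun v => Subtype.ext (funext fun i => by simp only [Subsingleton.elim i 0]) }
  have htail : (∑' ξ : ↥({0}ᶜ : Set K), (‖Ψ (algebraMap K (AdeleRing (𝓞 K) K) ξ * (u : AdeleRing (𝓞 K) K))‖ₑ : ℝ≥0∞)) ≤
      ENNReal.ofReal ((((r⁻¹ : ℝ≥0ˣ) : ℝ≥0) : ℝ) ^ θ) *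
        (B * ENNReal.ofReal ((max 1 (((1 : ℕ) : ℝ) ^ 2 * (GLn.archHeight 1 K (Matrix.GeneralLinearGroup.scalar (Fin 1) c) : ℝ))) ^ θ)) := by
    refine le_trans ?_ hray
    rw [← Equiv.tsum_eq eK.symm]
    exact ENNReal.tsum_le_tsum fun v => by
      have h := hdom (v.1 0)
      have hv : (fun _ : Fin 1 => v.1 0) = v.1 := funext fun i => by rw [Subsingleton.elim i 0]
      rw [hv] at h
      exact h
  have hRHS_ne_top : ENNReal.ofReal ((((r⁻¹ : ℝ≥0ˣ) : ℝ≥0) : ℝ) ^ θ) *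
      (B * ENNReal.ofReal ((max 1 (((1 : ℕ) : ℝ) ^ 2 * (GLn.archHeight 1 K (Matrix.GeneralLinearGroup.scalar (Fin 1) c) : ℝ))) ^ θ)) ≠ ⊤ :=
    ENNReal.mul_ne_top ENNReal.ofReal_ne_top (ENNReal.mul_ne_top hBtop ENNReal.ofReal_ne_top)
  have htail_ne_top := ne_top_of_le_ne_top hRHS_ne_top htail
  -- summability of the tail, then of the full sum over `K`
  have hsum_tail : Summable fun ξ : ↥({0}ᶜ : Set K) => ‖Ψ (algebraMap K (AdeleRing (𝓞 K) K) ξ * (u : AdeleRing (𝓞 K) K))‖ := by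
    have h := NNReal.summable_coe.2 (ENNReal.tsum_coe_ne_top_iff_summable.1 (by simpa only [enorm_eq_nnnorm] using htail_ne_top))
    simpa only [coe_nnnorm] using h
  have hsumK : Summable fun ξ : K => ‖Ψ (algebraMap K (AdeleRing (𝓞 K) K) ξ * (u : AdeleRing (𝓞 K) K))‖ := by
    refine (summable_subtype_and_compl (s := ({0}ᶜ : Set K))).1 ⟨hsum_tail, ?_⟩
    have hfin : (({0}ᶜ : Set K)ᶜ).Finite := by rw [compl_compl]; exact Set.finite_singleton 0
    exact hfin.summable (fun ξ : K => ‖Ψ (algebraMap K (AdeleRing (𝓞 K) K) ξ * (u : AdeleRing (𝓞 K) K))‖)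
  refine ⟨hsumK, ?_⟩
  -- the real tail sum is the `toReal` of the `ℝ≥0∞` one
  have hofReal : ENNReal.ofReal (∑' ξ : ↥({0}ᶜ : Set K), ‖Ψ (algebraMap K (AdeleRing (𝓞 K) K) ξ * (u : AdeleRing (𝓞 K) K))‖) ≤
      ENNReal.ofReal ((((r⁻¹ : ℝ≥0ˣ) : ℝ≥0) : ℝ) ^ θ) *
        (B * ENNReal.ofReal ((max 1 (((1 : ℕ) : ℝ) ^ 2 * (GLn.archHeight 1 K (Matrix.GeneralLinearGroup.scalar (Fin 1) c) : ℝ))) ^ θ)) := by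
    rw [ENNReal.ofReal_tsum_of_nonneg (fun _ => norm_nonneg _) hsum_tail]
    simp only [ofReal_norm]
    exact htail
  -- constants: `(r⁻¹)^θ`, `B.toReal`, `max 1 H(c)^θ ≤ m^θ`
  set mc : ℝ := max 1 (((1 : ℕ) : ℝ) ^ 2 * (GLn.archHeight 1 K (Matrix.GeneralLinearGroup.scalar (Fin 1) c) : ℝ)) with hmc
  have hmc0 : 0 ≤ mc := zero_le_one.trans (le_max_left _ _)
  have hmcm : mc ^ θ ≤ m ^ θ :=
    Real.rpow_le_rpow hmc0 (max_le_max le_rfl (mul_le_mul_of_nonneg_left (hHc c hc) (by positivity))) hθ0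
  have hrinv : (((r⁻¹ : ℝ≥0ˣ) : ℝ≥0) : ℝ) = (((r : ℝ≥0) : ℝ))⁻¹ := by rw [Units.val_inv_eq_inv_val, NNReal.coe_inv]
  have hr0 : 0 ≤ (((r : ℝ≥0) : ℝ))⁻¹ ^ θ := Real.rpow_nonneg (inv_nonneg.2 (NNReal.coe_nonneg _)) _
  have hR : ENNReal.ofReal ((((r⁻¹ : ℝ≥0ˣ) : ℝ≥0) : ℝ) ^ θ) * (B * ENNReal.ofReal (mc ^ θ)) = ENNReal.ofReal ((((r : ℝ≥0) : ℝ))⁻¹ ^ θ * (B.toReal * mc ^ θ)) := by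
    rw [hrinv]
    conv_lhs => rw [← ENNReal.ofReal_toReal hBtop, ← ENNReal.ofReal_mul ENNReal.toReal_nonneg, ← ENNReal.ofReal_mul hr0]
  rw [hR] at hofReal
  have hfin : ∑' ξ : ↥({0}ᶜ : Set K), ‖Ψ (algebraMap K (AdeleRing (𝓞 K) K) ξ * (u : AdeleRing (𝓞 K) K))‖ ≤ (((r : ℝ≥0) : ℝ))⁻¹ ^ θ * (B.toReal * mc ^ θ) :=
    (ENNReal.ofReal_le_ofReal_iff (mul_nonneg hr0 (mul_nonneg ENNReal.toReal_nonneg (Real.rpow_nonneg hmc0 _)))).1 hofReal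
  rw [← tsum_subtype]
  refine hfin.trans ?_
  exact mul_le_mul_of_nonneg_left (mul_le_mul_of_nonneg_left hmcm ENNReal.toReal_nonneg) hr0

/-! ## §3 The main theorem: decay under dilation by ANY idele -/

/-- **LATTICE SUMS OF A DECAYING FUNCTION DECAY UNDER IDELE DILATION** (see the module docstring): for `θ ∈ ([K:ℚ], k]` there is ONE `C ≥ 0` such that for every
`Ψ : 𝔸_K → ℂ` with `|Ψ(x)| ≤ M(1+‖x_∞‖)^{-k}` vanishing unless `x_f ∈ C_f`, and EVERY idele `t`: `Σ_{ξ ∈ K} |Ψ(ξ t)|` converges and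
`Σ_{ξ ≠ 0} |Ψ(ξ t)| ≤ C · |t|_𝔸^{-θ/[K:ℚ]}`.  (`K^×`-invariance §1 + `𝕀_K = K^×·C·z(ℝ_{>0})` ★ + ray decay §2 + product formula ★.)
[cite: GodementJacquetLNM260, §11] [cite: WeilBNT1967, Ch. IV §4 Thm 6] [cite: CasselsFrohlichANT1967, Ch. XV §4.2] -/
theorem exists_forall_tsum_indicator_norm_mul_le_rpow_neg {k : ℕ} {M : ℝ} (hM0 : 0 ≤ M) {Cf : Set (FiniteAdeleRing (𝓞 K) K)} (hCfc : IsCompact Cf)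
    {θ : ℝ} (hθ : (finrank ℚ K : ℝ) < θ) (hθk : θ ≤ k) :
    ∃ C : ℝ, 0 ≤ C ∧ ∀ Ψ : AdeleRing (𝓞 K) K → ℂ,
      (∀ x, ‖Ψ x‖ ≤ M * (1 + ‖InfiniteAdeleRing.ringEquiv_mixedSpace K x.1‖) ^ (-(k : ℝ))) → (∀ x, x.2 ∉ Cf → Ψ x = 0) →
      ∀ t : ideleGroup K,
        Summable (fun ξ : K => ‖Ψ (algebraMap K (AdeleRing (𝓞 K) K) ξ * (t : AdeleRing (𝓞 K) K))‖) ∧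
        ∑' ξ : K, ({0}ᶜ : Set K).indicator (fun ξ => ‖Ψ (algebraMap K (AdeleRing (𝓞 K) K) ξ * (t : AdeleRing (𝓞 K) K))‖) ξ ≤
          C * (((IdeleClassGroup.ideleNorm K t : ℝ≥0) : ℝ)) ^ (-(θ / (finrank ℚ K : ℝ))) := by
  obtain ⟨C, hCc, hCdec⟩ := exists_isCompact_normOneIdeles_subset K
  obtain ⟨B, hB0, hB⟩ := exists_forall_tsum_norm_mul_ray_le K hM0 hCfc hCc hθ hθk
  -- `|c|` is bounded on the compact `C`
  obtain ⟨b, hb⟩ := hCc.bddAbove_image (f := fun c : ideleGroup K => ((IdeleClassGroup.ideleNorm K c : ℝ≥0) : ℝ))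
    ((NNReal.continuous_coe.comp (continuous_ideleNorm_holds K)).continuousOn)
  have hbc : ∀ c ∈ C, ((IdeleClassGroup.ideleNorm K c : ℝ≥0) : ℝ) ≤ max b 1 := fun c hc => (hb ⟨c, hc, rfl⟩).trans (le_max_left _ _)
  have hb1 : 0 ≤ max b 1 := zero_le_one.trans (le_max_right _ _)
  have hθ0 : 0 ≤ θ := le_trans (by positivity) hθ.le
  have hd0 : (0 : ℝ) < (finrank ℚ K : ℝ) := Nat.cast_pos.2 finrank_pos
  have he0 : 0 ≤ θ / (finrank ℚ K : ℝ) := div_nonneg hθ0 hd0.le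
  refine ⟨B * (max b 1) ^ (θ / (finrank ℚ K : ℝ)), mul_nonneg hB0 (Real.rpow_nonneg hb1 _), ?_⟩
  intro Ψ hM hCf t
  -- `t = q · c · z(r)`
  obtain ⟨y, hy, r, hty⟩ := exists_normOneIdeles_mul_posRealIdele (K := K) t
  obtain ⟨q, hq, c, hc, hyq⟩ := hCdec y hy
  have ht : t = q * (c * posRealIdele K r) := by rw [hty, hyq, mul_assoc]
  obtain ⟨hsum, hle⟩ := hB Ψ hM hCf c hc r
  refine ⟨?_, ?_⟩
  · rw [ht]; exact (summable_norm_mul_principal_iff K Ψ hq _).2 hsum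
  have hS : ∑' ξ : K, ({0}ᶜ : Set K).indicator (fun ξ => ‖Ψ (algebraMap K (AdeleRing (𝓞 K) K) ξ * (t : AdeleRing (𝓞 K) K))‖) ξ =
      ∑' ξ : K, ({0}ᶜ : Set K).indicator (fun ξ => ‖Ψ (algebraMap K (AdeleRing (𝓞 K) K) ξ * ((c * posRealIdele K r : ideleGroup K) : AdeleRing (𝓞 K) K))‖) ξ := by
    rw [ht]; exact tsum_indicator_norm_mul_principal K Ψ hq _
  rw [hS]
  refine hle.trans ?_
  -- the norms: `|t| = |c| · r^d`
  set ρ : ℝ := ((r : ℝ≥0) : ℝ) with hρ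
  set nc : ℝ := ((IdeleClassGroup.ideleNorm K c : ℝ≥0) : ℝ) with hnc
  have hρ0 : 0 < ρ := NNReal.coe_pos.2 (pos_iff_ne_zero.2 r.ne_zero)
  have hnc0 : 0 < nc := NNReal.coe_pos.2 (pos_iff_ne_zero.2 (ideleNorm_ne_zero c))
  have hnorm : ((IdeleClassGroup.ideleNorm K t : ℝ≥0) : ℝ) = nc * ρ ^ (finrank ℚ K) := by
    rw [ht, map_mul, map_mul, ideleNorm_principal hq, one_mul, ideleNorm_posRealIdele_holds K r, NNReal.coe_mul, NNReal.coe_pow]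
  rw [hnorm]
  have e1 : ρ⁻¹ ^ θ = ρ ^ (-θ) := by rw [Real.inv_rpow hρ0.le, Real.rpow_neg hρ0.le]
  have e2 : (nc * ρ ^ (finrank ℚ K)) ^ (-(θ / (finrank ℚ K : ℝ))) = nc ^ (-(θ / (finrank ℚ K : ℝ))) * ρ ^ (-θ) := by
    rw [Real.mul_rpow hnc0.le (pow_nonneg hρ0.le _), ← Real.rpow_natCast ρ (finrank ℚ K), ← Real.rpow_mul hρ0.le]
    congr 2
    field_simp
  rw [e1, e2]
  have key : B ≤ B * (max b 1) ^ (θ / (finrank ℚ K : ℝ)) * nc ^ (-(θ / (finrank ℚ K : ℝ))) := by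
    have h1 : 1 ≤ (max b 1) ^ (θ / (finrank ℚ K : ℝ)) * nc ^ (-(θ / (finrank ℚ K : ℝ))) := by
      rw [Real.rpow_neg hnc0.le, ← div_eq_mul_inv, one_le_div (Real.rpow_pos_of_pos hnc0 _)]
      exact Real.rpow_le_rpow hnc0.le (hbc c hc) he0
    calc B = B * 1 := (mul_one B).symm
      _ ≤ B * ((max b 1) ^ (θ / (finrank ℚ K : ℝ)) * nc ^ (-(θ / (finrank ℚ K : ℝ)))) := mul_le_mul_of_nonneg_left h1 hB0
      _ = B * (max b 1) ^ (θ / (finrank ℚ K : ℝ)) * nc ^ (-(θ / (finrank ℚ K : ℝ))) := (mul_assoc _ _ _).symm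
  calc ρ ^ (-θ) * B = B * ρ ^ (-θ) := mul_comm _ _
    _ ≤ (B * (max b 1) ^ (θ / (finrank ℚ K : ℝ)) * nc ^ (-(θ / (finrank ℚ K : ℝ)))) * ρ ^ (-θ) :=
        mul_le_mul_of_nonneg_right key (Real.rpow_nonneg hρ0.le _)
    _ = B * (max b 1) ^ (θ / (finrank ℚ K : ℝ)) * (nc ^ (-(θ / (finrank ℚ K : ℝ))) * ρ ^ (-θ)) := by ring

/-! ## §4 Corollaries: the Schwartz class (every exponent), and the `λ⁻¹` form of the Maass–Selberg page -/

/-- **SCHWARTZ–BRUHAT CLASS: decay of EVERY order on `{|t| ≥ 1}`**: if the class decays to every archimedean order (`∀ k, |Ψ(x)| ≤ M k · (1+‖x_∞‖)^{-k}`, common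
constants `M k`) and vanishes off `C_f`, then for every real `β` ONE constant `C ≥ 0` gives `Σ_{ξ ≠ 0} |Ψ(ξ t)| ≤ C |t|^{-β}` for all `|t| ≥ 1` and all `Ψ` in the class.
[cite: GodementJacquetLNM260, §11] [cite: CasselsFrohlichANT1967, Ch. XV §4.2] -/
theorem exists_forall_tsum_indicator_norm_mul_le_rpow_neg_of_forall {M : ℕ → ℝ} (hM0 : ∀ k, 0 ≤ M k) {Cf : Set (FiniteAdeleRing (𝓞 K) K)}
    (hCfc : IsCompact Cf) (β : ℝ) :
    ∃ C : ℝ, 0 ≤ C ∧ ∀ Ψ : AdeleRing (𝓞 K) K → ℂ,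
      (∀ (k : ℕ) (x : AdeleRing (𝓞 K) K), ‖Ψ x‖ ≤ M k * (1 + ‖InfiniteAdeleRing.ringEquiv_mixedSpace K x.1‖) ^ (-(k : ℝ))) → (∀ x, x.2 ∉ Cf → Ψ x = 0) →
      ∀ t : ideleGroup K, 1 ≤ IdeleClassGroup.ideleNorm K t →
        Summable (fun ξ : K => ‖Ψ (algebraMap K (AdeleRing (𝓞 K) K) ξ * (t : AdeleRing (𝓞 K) K))‖) ∧
        ∑' ξ : K, ({0}ᶜ : Set K).indicator (fun ξ => ‖Ψ (algebraMap K (AdeleRing (𝓞 K) K) ξ * (t : AdeleRing (𝓞 K) K))‖) ξ ≤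
          C * (((IdeleClassGroup.ideleNorm K t : ℝ≥0) : ℝ)) ^ (-β) := by
  have hd0 : (0 : ℝ) < (finrank ℚ K : ℝ) := Nat.cast_pos.2 finrank_pos
  -- an exponent `θ > d` with `θ / d ≥ β`, and an order `k ≥ θ`
  set θ : ℝ := max (β * (finrank ℚ K : ℝ)) ((finrank ℚ K : ℝ) + 1) with hθdef
  have hθ : (finrank ℚ K : ℝ) < θ := lt_of_lt_of_le (lt_add_one _) (le_max_right _ _)
  have hθ0 : 0 ≤ θ := hd0.le.trans hθ.le
  set k : ℕ := ⌈θ⌉₊ with hk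
  have hθk : θ ≤ k := Nat.le_ceil θ
  obtain ⟨C, hC0, hC⟩ := exists_forall_tsum_indicator_norm_mul_le_rpow_neg K (hM0 k) hCfc hθ hθk
  refine ⟨C, hC0, fun Ψ hM hCf t ht => ?_⟩
  obtain ⟨hsum, hle⟩ := hC Ψ (hM k) hCf t
  refine ⟨hsum, hle.trans (mul_le_mul_of_nonneg_left ?_ hC0)⟩
  -- `|t|^{-θ/d} ≤ |t|^{-β}` for `|t| ≥ 1` since `β ≤ θ/d`
  have hβθ : β ≤ θ / (finrank ℚ K : ℝ) := by rw [le_div_iff₀ hd0]; exact le_max_left _ _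
  exact Real.rpow_le_rpow_of_exponent_le (by exact_mod_cast ht) (neg_le_neg hβθ)

/-- **THE `λ⁻¹` FORM** consumed by the Maass–Selberg page (★ `K2E1EisensteinMinusConstantTermBoundU2.norm_sub_borelConstantTerm_le_of_decay_two`, binder `hdec`, with
`Ψ := 𝓕Φ_k`): for `|λ| ≤ 1`, `Σ_{ξ ≠ 0} |Ψ(ξ λ⁻¹)| ≤ C · (|λ|⁻¹)^{-β}`. [cite: GodementJacquetLNM260, §11] [cite: CasselsFrohlichANT1967, Ch. XV §4.2] -/
theorem exists_forall_tsum_indicator_norm_mul_inv_le {M : ℕ → ℝ} (hM0 : ∀ k, 0 ≤ M k) {Cf : Set (FiniteAdeleRing (𝓞 K) K)}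
    (hCfc : IsCompact Cf) (β : ℝ) :
    ∃ C : ℝ, 0 ≤ C ∧ ∀ Ψ : AdeleRing (𝓞 K) K → ℂ,
      (∀ (k : ℕ) (x : AdeleRing (𝓞 K) K), ‖Ψ x‖ ≤ M k * (1 + ‖InfiniteAdeleRing.ringEquiv_mixedSpace K x.1‖) ^ (-(k : ℝ))) → (∀ x, x.2 ∉ Cf → Ψ x = 0) →
      ∀ lam : ideleGroup K, IdeleClassGroup.ideleNorm K lam ≤ 1 →
        Summable (fun ξ : K => ‖Ψ (algebraMap K (AdeleRing (𝓞 K) K) ξ * ((lam⁻¹ : ideleGroup K) : AdeleRing (𝓞 K) K))‖) ∧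
        ∑' ξ : K, ({0}ᶜ : Set K).indicator (fun ξ => ‖Ψ (algebraMap K (AdeleRing (𝓞 K) K) ξ * ((lam⁻¹ : ideleGroup K) : AdeleRing (𝓞 K) K))‖) ξ ≤
          C * ((((IdeleClassGroup.ideleNorm K lam : ℝ≥0) : ℝ))⁻¹) ^ (-β) := by
  obtain ⟨C, hC0, hC⟩ := exists_forall_tsum_indicator_norm_mul_le_rpow_neg_of_forall K hM0 hCfc β
  refine ⟨C, hC0, fun Ψ hM hCf lam hlam => ?_⟩
  have h0 : IdeleClassGroup.ideleNorm K lam ≠ 0 := ideleNorm_ne_zero lam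
  have h1 : 1 ≤ IdeleClassGroup.ideleNorm K lam⁻¹ := by rw [map_inv]; exact one_le_inv_iff₀.2 ⟨pos_iff_ne_zero.2 h0, hlam⟩
  obtain ⟨hsum, hle⟩ := hC Ψ hM hCf lam⁻¹ h1
  refine ⟨hsum, ?_⟩
  rwa [map_inv, NNReal.coe_inv] at hle

end Summit.HodgeConjecture.HodgeConjecture.Cruxes.H413.K2E1AdelicFourierDecay

end
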